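import Literature.Analysis.FunctionSpaces.BesselIGeneratingFunction
import Mathlib.Analysis.Convex.Mul
import HarnessLib

/-!
# Power series with non-negative coefficients are convex, monotone and non-negative on `[0, ∞)`;
# the modified Bessel functions `I_n(x)` and the link weights `I_{n+1}(x)/x` — PROVED

Topic `Literature/Analysis/Convex`. Theorems only (no definition, no named fact).

## 1. Non-negative coefficients

If `g(t) = Σ_k c_k t^{m_k}` on a convex set `s ⊆ [0, ∞)` with all `c_k ≥ 0` (any exponents
`m_k ∈ ℕ`, convergence as a `HasSum`), then `g` is CONVEX, MONOTONE (non-decreasing) and NON-NEGATIVE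
on `s` (`convexOn_of_hasSum_mul_pow`, `monotoneOn_of_hasSum_mul_pow`, `nonneg_of_hasSum_mul_pow`):
each `t ↦ t^m` is convex on `[0, ∞)` (Mathlib `convexOn_pow`), monotone and non-negative, and these
properties pass to non-negative combinations [cite: HiriarturrutyLemarechal2001, Prop. B.2.1.1
(PDF p. 94)] and to sums of series termwise (`hasSum_le`). Finite PRODUCTS of functions that are
convex, monotone and non-negative on a convex set are again such (`convexOn_finset_prod`; Mathlib's
`ConvexOn.mul` for monovarying non-negative factors).

## 2. Bessel instances

For the tree's modified Bessel functions `besselI n` (integral-defined, with the power series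
`I_n(x) = Σ_k (x/2)^{2k+n}/(k!(k+n)!)`, `hasSum_besselI` [cite: DLMF, 10.25.2]):
* `convexOn_besselI`, `monotoneOn_besselI` — `I_n` is convex and non-decreasing on `[0, ∞)`;
* `hasSum_besselI_succ_div` — `I_{n+1}(x)/x = Σ_k x^{2k+n} / (2^{2k+n+1} k! (k+n+1)!)` for `x ≠ 0`;
* `convexOn_besselI_succ_div`, `monotoneOn_besselI_succ_div`, `besselI_succ_div_nonneg` — the
  functions `x ↦ I_{n+1}(x)/x` are convex, non-decreasing and non-negative on `(0, ∞)` (on the OPEN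
  half-line: at `x = 0` Lean's `I₁(0)/0 = 0` is a junk value below the limit `1/2`);
* `convexOn_finset_prod_besselI_succ_div` — finite products `x ↦ Π_ℓ I_{n_ℓ+1}(x)/x` are convex,
  non-decreasing and non-negative on `(0, ∞)`.

## 3. Why this file exists (application, by dictionary only)

In the character expansion of `SU(2)` lattice gauge theory the link weights are
`a_j(β) = 2 I_{2j+1}(β)/β` and a truncated transfer matrix in the character basis is a diagonal
congruence `diag(√k_c(β_t)) Q diag(√k_c(β_t))` with `k_c = Π_links a_{j_ℓ}`; §2 supplies the convexity
of the `k_c` in `β_t > 0` that `Literature/Analysis/OperatorTheory/DiagonalCongruenceNormConvex.lean`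
(`convexOn_l2_opNorm_sqrt_congr`) takes as hypothesis. Nothing about lattice gauge theory is
formalised here.

## References

* J.-B. Hiriart-Urruty, C. Lemaréchal, *Fundamentals of Convex Analysis*, Springer 2001,
  Prop. B.2.1.1 (positive combinations of convex functions). [HiriarturrutyLemarechal2001]
* NIST DLMF §10.25.2 (series of `I_ν`). [DLMF]
-/

noncomputable section

open Set Filter Topology Finset
open scoped Nat

namespace Literature.Analysis.Convex

/-! ## 1. Series with non-negative coefficients; finite products -/

section NonnegCoeff

variable {c : ℕ → ℝ} {m : ℕ → ℕ} {g : ℝ → ℝ} {s : Set ℝ}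

/-- **A power sum with non-negative coefficients is convex on `[0, ∞)`**: if
`g t = Σ_k c_k t^{m_k}` (`HasSum`) for `t` in a convex set `s ⊆ [0, ∞)` and all `c_k ≥ 0`, then `g` is
convex on `s`. [cite: HiriarturrutyLemarechal2001, Prop. B.2.1.1 (PDF p. 94)] -/
theorem convexOn_of_hasSum_mul_pow (hs : s ⊆ Ici 0) (hsc : Convex ℝ s) (hc : ∀ k, 0 ≤ c k)
    (hg : ∀ t ∈ s, HasSum (fun k => c k * t ^ m k) (g t)) : ConvexOn ℝ s g := by
  refine ⟨hsc, fun x hx y hy a b ha hb hab => ?_⟩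
  have hxy : a • x + b • y ∈ s := hsc hx hy ha hb hab
  have h1 := hg _ hxy
  have h2 : HasSum (fun k => a * (c k * x ^ m k) + b * (c k * y ^ m k)) (a * g x + b * g y) :=
    ((hg x hx).mul_left a).add ((hg y hy).mul_left b)
  simp only [smul_eq_mul] at h1 ⊢
  refine hasSum_le (fun k => ?_) h1 h2
  have hk := (convexOn_pow (𝕜 := ℝ) (m k)).2 (hs hx) (hs hy) ha hb hab
  simp only [smul_eq_mul] at hk
  calc c k * (a * x + b * y) ^ m k ≤ c k * (a * x ^ m k + b * y ^ m k) :=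
        mul_le_mul_of_nonneg_left hk (hc k)
    _ = a * (c k * x ^ m k) + b * (c k * y ^ m k) := by ring

/-- **A power sum with non-negative coefficients is non-decreasing on `[0, ∞)`.**
[cite: HiriarturrutyLemarechal2001, Prop. B.2.1.1 (PDF p. 94)] -/
theorem monotoneOn_of_hasSum_mul_pow (hs : s ⊆ Ici 0) (hc : ∀ k, 0 ≤ c k)
    (hg : ∀ t ∈ s, HasSum (fun k => c k * t ^ m k) (g t)) : MonotoneOn g s := by
  intro x hx y hy hxy
  exact hasSum_le (fun k => mul_le_mul_of_nonneg_left (pow_le_pow_left₀ (hs hx) hxy _) (hc k))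
    (hg x hx) (hg y hy)

/-- **A power sum with non-negative coefficients is non-negative on `[0, ∞)`.**
[cite: HiriarturrutyLemarechal2001, Prop. B.2.1.1 (PDF p. 94)] -/
theorem nonneg_of_hasSum_mul_pow (hs : s ⊆ Ici 0) (hc : ∀ k, 0 ≤ c k)
    (hg : ∀ t ∈ s, HasSum (fun k => c k * t ^ m k) (g t)) : ∀ t ∈ s, 0 ≤ g t :=
  fun t ht => (hg t ht).nonneg fun k => mul_nonneg (hc k) (pow_nonneg (hs ht) _)

/-- **Finite products of convex, non-decreasing, non-negative functions** on a convex set of reals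
are convex, non-decreasing and non-negative (induction with Mathlib's `ConvexOn.mul`: two
non-negative convex functions that vary monotonically together have a convex product).
[cite: HiriarturrutyLemarechal2001, Prop. B.2.1.1 (PDF p. 94)] -/
theorem convexOn_finset_prod {ι : Type*} (T : Finset ι) (F : ι → ℝ → ℝ) (hsc : Convex ℝ s)
    (hconv : ∀ i ∈ T, ConvexOn ℝ s (F i)) (hmono : ∀ i ∈ T, MonotoneOn (F i) s)
    (hnn : ∀ i ∈ T, ∀ t ∈ s, 0 ≤ F i t) :
    ConvexOn ℝ s (fun t => ∏ i ∈ T, F i t) ∧ MonotoneOn (fun t => ∏ i ∈ T, F i t) s ∧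
      ∀ t ∈ s, 0 ≤ ∏ i ∈ T, F i t := by
  classical
  induction T using Finset.induction_on with
  | empty =>
    simp only [Finset.prod_empty]
    exact ⟨convexOn_const 1 hsc, fun _ _ _ _ _ => le_rfl, fun _ _ => zero_le_one⟩
  | insert i T hi ih =>
    obtain ⟨hc, hm, hn⟩ := ih (fun j hj => hconv j (Finset.mem_insert_of_mem hj))
      (fun j hj => hmono j (Finset.mem_insert_of_mem hj))
      (fun j hj => hnn j (Finset.mem_insert_of_mem hj))
    have hci := hconv i (Finset.mem_insert_self i T)
    have hmi := hmono i (Finset.mem_insert_self i T)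
    have hni := hnn i (Finset.mem_insert_self i T)
    have hfun : (fun t => ∏ j ∈ insert i T, F j t) = F i * fun t => ∏ j ∈ T, F j t := by
      funext t
      rw [Finset.prod_insert hi, Pi.mul_apply]
    rw [hfun]
    refine ⟨hci.mul hc (fun t ht => hni t ht) (fun t ht => hn t ht) (hmi.monovaryOn hm), ?_, ?_⟩
    · intro x hx y hy hxy
      simp only [Pi.mul_apply]
      exact mul_le_mul (hmi hx hy hxy) (hm hx hy hxy) (hn x hx) (hni y hy)
    · intro t ht
      rw [Finset.prod_insert hi]
      exact mul_nonneg (hni t ht) (hn t ht)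

end NonnegCoeff

/-! ## 2. The modified Bessel functions `I_n` and the link weights `I_{n+1}(x)/x` -/

section Bessel

open Literature.Analysis.FunctionSpaces

/-- The power series of `I_n` in coefficient form: `I_n(x) = Σ_k x^{2k+n} / (2^{2k+n} k! (k+n)!)`.
[cite: DLMF, 10.25.2] -/
theorem hasSum_besselI_coeff (n : ℕ) (x : ℝ) :
    HasSum (fun k : ℕ => (1 / (2 ^ (2 * k + n) * ((k ! : ℝ) * ((k + n) ! : ℝ)))) * x ^ (2 * k + n))
      (besselI n x) := by
  refine (hasSum_besselI n x).congr_fun fun k => ?_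
  rw [div_pow]
  ring

/-- **`I_n` is convex on `[0, ∞)`** (power series with non-negative coefficients).
[cite: DLMF, 10.25.2] [cite: HiriarturrutyLemarechal2001, Prop. B.2.1.1 (PDF p. 94)] -/
theorem convexOn_besselI (n : ℕ) : ConvexOn ℝ (Ici 0) (besselI n) :=
  convexOn_of_hasSum_mul_pow (m := fun k => 2 * k + n) subset_rfl (convex_Ici 0)
    (fun k => by positivity) fun t _ => hasSum_besselI_coeff n t

/-- **`I_n` is non-decreasing on `[0, ∞)`.** [cite: DLMF, 10.25.2] -/
theorem monotoneOn_besselI (n : ℕ) : MonotoneOn (besselI n) (Ici 0) :=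
  monotoneOn_of_hasSum_mul_pow (m := fun k => 2 * k + n) subset_rfl (fun k => by positivity)
    fun t _ => hasSum_besselI_coeff n t

/-- **The link-weight series**: for `x ≠ 0`, `I_{n+1}(x)/x = Σ_k x^{2k+n} / (2^{2k+n+1} k! (k+n+1)!)`.
[cite: DLMF, 10.25.2] -/
theorem hasSum_besselI_succ_div (n : ℕ) {x : ℝ} (hx : x ≠ 0) :
    HasSum (fun k : ℕ =>
      (1 / (2 ^ (2 * k + n + 1) * ((k ! : ℝ) * ((k + (n + 1)) ! : ℝ)))) * x ^ (2 * k + n))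
      (besselI (n + 1) x / x) := by
  refine ((hasSum_besselI_coeff (n + 1) x).div_const x).congr_fun fun k => ?_
  have h2 : 2 * k + (n + 1) = 2 * k + n + 1 := by ring
  rw [h2, pow_succ x (2 * k + n)]
  field_simp

/-- **`x ↦ I_{n+1}(x)/x` is convex on `(0, ∞)`** (non-negative coefficients; on the open half-line,
where the Lean function agrees with the series). [cite: DLMF, 10.25.2]
[cite: HiriarturrutyLemarechal2001, Prop. B.2.1.1 (PDF p. 94)] -/
theorem convexOn_besselI_succ_div (n : ℕ) :
    ConvexOn ℝ (Ioi 0) (fun x => besselI (n + 1) x / x) :=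
  convexOn_of_hasSum_mul_pow (m := fun k => 2 * k + n) Ioi_subset_Ici_self (convex_Ioi 0)
    (fun k => by positivity) fun t ht => hasSum_besselI_succ_div n (ne_of_gt ht)

/-- **`x ↦ I_{n+1}(x)/x` is non-decreasing on `(0, ∞)`.** [cite: DLMF, 10.25.2] -/
theorem monotoneOn_besselI_succ_div (n : ℕ) :
    MonotoneOn (fun x => besselI (n + 1) x / x) (Ioi 0) :=
  monotoneOn_of_hasSum_mul_pow (m := fun k => 2 * k + n) Ioi_subset_Ici_self
    (fun k => by positivity) fun t ht => hasSum_besselI_succ_div n (ne_of_gt ht)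

/-- `I_{n+1}(x)/x ≥ 0` for `x > 0`. [cite: DLMF, 10.25.2] -/
theorem besselI_succ_div_nonneg (n : ℕ) {x : ℝ} (hx : 0 < x) : 0 ≤ besselI (n + 1) x / x :=
  nonneg_of_hasSum_mul_pow (m := fun k => 2 * k + n) Ioi_subset_Ici_self
    (fun k => by positivity) (fun t ht => hasSum_besselI_succ_div n (ne_of_gt ht)) x hx

/-- **Products of link weights are convex**: for any finite family of orders `n_ℓ`, the function
`x ↦ Π_ℓ I_{n_ℓ+1}(x)/x` is convex, non-decreasing and non-negative on `(0, ∞)` — e.g. the `SU(2)`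
character-expansion weights `k_c(β) = Π_links 2 I_{2j_ℓ+1}(β)/β` up to the constant `2^{#links}`.
[cite: DLMF, 10.25.2] [cite: HiriarturrutyLemarechal2001, Prop. B.2.1.1 (PDF p. 94)] -/
theorem convexOn_finset_prod_besselI_succ_div {ι : Type*} (L : Finset ι) (nℓ : ι → ℕ) :
    ConvexOn ℝ (Ioi 0) (fun x => ∏ ℓ ∈ L, besselI (nℓ ℓ + 1) x / x) ∧
      MonotoneOn (fun x => ∏ ℓ ∈ L, besselI (nℓ ℓ + 1) x / x) (Ioi 0) ∧
      ∀ x ∈ Ioi (0 : ℝ), 0 ≤ ∏ ℓ ∈ L, besselI (nℓ ℓ + 1) x / x :=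
  convexOn_finset_prod L (fun ℓ x => besselI (nℓ ℓ + 1) x / x) (convex_Ioi 0)
    (fun ℓ _ => convexOn_besselI_succ_div (nℓ ℓ)) (fun ℓ _ => monotoneOn_besselI_succ_div (nℓ ℓ))
    fun ℓ _ _ hx => besselI_succ_div_nonneg (nℓ ℓ) hx

end Bessel

end Literature.Analysis.Convex

end
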